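import Summits.MatrixMultiplication.MatrixMultiplication.Theorems.OutsiderSandwichFirstOrder
import HarnessLib

/-!
# A level-independent rate: `5m ≤ 4B` for `⟨B⟩ ⊠ C₁^{⊠N} ⊵ ⟨m⟩ ⊠ ⟨2,2,2⟩^{⊠N}`, every `N ≥ 1`

Route `OutsiderSandwich` (decomposition cell `decomp-mm`, lens 4 «minimal counterexample /
extremal reduction», gen 28, addendum), support for the aside leaf `BlockOneIsMM`
(stmt-MatrixMultiplication-27147).  Fourth rung of the rate ladder, and the first one that does
not decay with the level: the previous rungs gave rates `1 + 2·4^{-N}`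
(`OutsiderSandwichLevelRate{,Two}`) and `1 + 2^{-N}` (`OutsiderSandwichLevelRateThree`,
Dieudonné); here the first-order condition (`OutsiderSandwichFirstOrder`) and simultaneous
generic rank (`OutsiderSandwichGenericRank`) give the core bound `3n²/2` and the uniform rate
`5/4`.  The ceiling of the method (`3/2`, Flanders) is `OutsiderSandwichGenericRank`'s
conditional theorem.

* `two_mul_pairRank_add_sq_le` — **core bound `3n²/2`**: a space `L` of pairs of `n × n`
  matrices with `V·Y = 0` on `L` has `2(dim π₁L + dim π₂L) + n² ≤ 4n²`.  (Generic pair with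
  ranks `r + s ≤ n`; first-order count `dim π₁L ≤ n² − (n − r)²`, `dim π₂L ≤ n² − (n − s)²`;
  and `(n − r)² + (n − s)² ≥ n²/2`.)
* `rate_law₄` — `Amortised N B m ⟹ 5m ≤ 4B` for every `N ≥ 1`;
  `rate_amortisedNumber₄ : 5m ≤ 4·a(N, m)`; `a(3,5) ≥ 7`, `¬Amortised 3 6 5`,
  `¬Amortised N B m` whenever `4B < 5m`.

## References
* D. Coppersmith, S. Winograd, *Matrix multiplication via arithmetic progressions*,
  J. Symbolic Comput. 9 (1990) 251–280, §7. [CoppersmithWinograd1990]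
* P. Bürgisser, M. Clausen, M. A. Shokrollahi, *Algebraic Complexity Theory*, Springer (1997),
  §17.1. [BurgisserClausenShokrollahi1997]
-/

noncomputable section
open scoped BigOperators Matrix
set_option linter.dupNamespace false
set_option autoImplicit false

namespace Summit.MatrixMultiplication.MatrixMultiplication.Theorems.OutsiderSandwichLevelRateFour

open Literature.Computability.AlgebraicComplexity
open Summit.MatrixMultiplication.MatrixMultiplication.Theorems.OutsiderSandwichAmortised
open Summit.MatrixMultiplication.MatrixMultiplication.Theorems.OutsiderSandwichAmortisedTable
open Summit.MatrixMultiplication.MatrixMultiplication.Theorems.OutsiderSandwichLevelLaw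
open Summit.MatrixMultiplication.MatrixMultiplication.Theorems.OutsiderSandwichGenericRank
open Summit.MatrixMultiplication.MatrixMultiplication.Theorems.OutsiderSandwichFirstOrder

/-! ## 1. The core bound `3n²/2` -/

section Core

variable {ρ : Type} [Fintype ρ] [DecidableEq ρ]

omit [DecidableEq ρ] in
/-- `n² ≤ 2((n − r)² + (n − s)²)` when `r + s ≤ n`. [folklore] -/
theorem sq_le_two_mul {n r s : ℕ} (h : r + s ≤ n) :
    n ^ 2 ≤ 2 * ((n - r) ^ 2 + (n - s) ^ 2) := by
  obtain ⟨a, ha⟩ : ∃ a, a = n - r := ⟨_, rfl⟩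
  obtain ⟨b, hb⟩ : ∃ b, b = n - s := ⟨_, rfl⟩
  rw [← ha, ← hb]
  have hab : n ≤ a + b := by omega
  have key : (n : ℤ) ^ 2 ≤ 2 * ((a : ℤ) ^ 2 + (b : ℤ) ^ 2) := by
    have hab' : (n : ℤ) ≤ a + b := by exact_mod_cast hab
    nlinarith [mul_nonneg (sub_nonneg.2 hab') (by positivity : (0 : ℤ) ≤ a + b + n),
      sq_nonneg ((a : ℤ) - b)]
  exact_mod_cast key

/-- **Core bound `3n²/2`.**  A space `L` of pairs of `n × n` matrices with `V·Y = 0` on `L` has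
`2(dim π₁L + dim π₂L) + n² ≤ 4n²`. [cite: BurgisserClausenShokrollahi1997, §17.1] -/
theorem two_mul_pairRank_add_sq_le (L : Submodule ℂ (Matrix ρ ρ ℂ × Matrix ρ ρ ℂ))
    (hL : ∀ x ∈ L, x.1 * x.2 = 0) :
    2 * pairRank ρ L + Fintype.card ρ ^ 2 ≤ 4 * Fintype.card ρ ^ 2 := by
  classical
  obtain ⟨X₁, ⟨x₁, hx₁, rfl⟩, hmax₁⟩ :=
    exists_max_rank (Prod.fst '' (L : Set (Matrix ρ ρ ℂ × Matrix ρ ρ ℂ))) ⟨_, 0, L.zero_mem, rfl⟩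
  obtain ⟨Y₂, ⟨x₂, hx₂, rfl⟩, hmax₂⟩ :=
    exists_max_rank (Prod.snd '' (L : Set (Matrix ρ ρ ℂ × Matrix ρ ρ ℂ))) ⟨_, 0, L.zero_mem, rfl⟩
  obtain ⟨t, ht₁, ht₂⟩ := exists_simultaneous x₁ x₂
  have hz : x₁ + t • x₂ ∈ L := L.add_mem hx₁ (L.smul_mem t hx₂)
  have hsum := rank_add_rank_le _ _ (hL _ hz)
  rw [Prod.fst_add, Prod.snd_add, Prod.smul_fst, Prod.smul_snd] at hsum
  have hrs : x₁.1.rank + x₂.2.rank ≤ Fintype.card ρ := by omega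
  have hP := finrank_add_sq_le (L.map (LinearMap.fst ℂ (Matrix ρ ρ ℂ) (Matrix ρ ρ ℂ)))
    (X₀ := x₁.1) (Submodule.mem_map.2 ⟨x₁, hx₁, rfl⟩) fun X hX => by
      obtain ⟨y, hy, rfl⟩ := Submodule.mem_map.1 hX
      exact hmax₁ _ ⟨y, hy, rfl⟩
  have hQ := finrank_add_sq_le (L.map (LinearMap.snd ℂ (Matrix ρ ρ ℂ) (Matrix ρ ρ ℂ)))
    (X₀ := x₂.2) (Submodule.mem_map.2 ⟨x₂, hx₂, rfl⟩) fun Y hY => by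
      obtain ⟨y, hy, rfl⟩ := Submodule.mem_map.1 hY
      exact hmax₂ _ ⟨y, hy, rfl⟩
  have key := sq_le_two_mul hrs
  unfold pairRank
  omega

end Core

/-! ## 2. The format `2^N` and the level-independent rate -/

/-- The core bound `6·4^k = 3·4^{k+1}/2` at format `2^{k+1}`.
[cite: BurgisserClausenShokrollahi1997, §17.1] -/
theorem pairRank_le_six (k : ℕ)
    (L : Submodule ℂ (Matrix (Fin (k + 1) → Fin 2) (Fin (k + 1) → Fin 2) ℂ ×
      Matrix (Fin (k + 1) → Fin 2) (Fin (k + 1) → Fin 2) ℂ))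
    (hL : ∀ x ∈ L, x.1 * x.2 = 0) : pairRank (Fin (k + 1) → Fin 2) L ≤ 6 * 4 ^ k := by
  have hcard : Fintype.card (Fin (k + 1) → Fin 2) = 2 ^ (k + 1) := by
    simp only [Fintype.card_fun, Fintype.card_fin]
  have h4 : Fintype.card (Fin (k + 1) → Fin 2) ^ 2 = 4 ^ k * 4 := by
    rw [hcard, ← pow_mul, mul_comm, pow_mul, ← pow_succ]; norm_num
  have h := two_mul_pairRank_add_sq_le L hL
  rw [h4] at h
  omega

/-- **Rate law, fourth rung — level-independent**: `Amortised N B m ⟹ 5m ≤ 4B` (`N ≥ 1`).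
[cite: CoppersmithWinograd1990, §7] -/
theorem rate_law₄ {N B m : ℕ} (hN : 1 ≤ N) (h : Amortised N B m) : 5 * m ≤ 4 * B := by
  obtain ⟨k, rfl⟩ : ∃ k, N = k + 1 := ⟨N - 1, by omega⟩
  have key := level_law (le_refl _ |>.trans hN) (Equiv.refl _)
    (fun L hL => pairRank_le_six k L hL) h
  rw [pow_succ] at key
  have e1 : 4 * m * (4 ^ k * 4) = 16 * (m * 4 ^ k) := by ring
  have e2 : m * (6 * 4 ^ k) = 6 * (m * 4 ^ k) := by ring
  have e3 : 2 * B * (4 ^ k * 4) = 8 * (B * 4 ^ k) := by ring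
  rw [e1, e2, e3] at key
  have hK : 0 < 4 ^ k := by positivity
  refine Nat.le_of_mul_le_mul_right (c := 4 ^ k) ?_ hK
  have l1 : 5 * m * 4 ^ k = 5 * (m * 4 ^ k) := by ring
  have l2 : 4 * B * 4 ^ k = 4 * (B * 4 ^ k) := by ring
  rw [l1, l2]
  omega

/-- **`5m ≤ 4·a(N, m)` for every `N ≥ 1`**: the level-`N` rate of `C₁` over `⟨2,2,2⟩` is at
least `5/4`, uniformly in `N`. [cite: CoppersmithWinograd1990, §7] -/
theorem rate_amortisedNumber₄ {N : ℕ} (hN : 1 ≤ N) (m : ℕ) :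
    5 * m ≤ 4 * amortisedNumber N m :=
  rate_law₄ hN (amortised_amortisedNumber N m)

/-- `4B < 5m ⟹ ⟨B⟩ ⊠ C₁^{⊠N} ⋭ ⟨m⟩ ⊠ ⟨2,2,2⟩^{⊠N}` (`N ≥ 1`). [cite: CoppersmithWinograd1990, §7] -/
theorem not_amortised_of_lt {N B m : ℕ} (hN : 1 ≤ N) (hlt : 4 * B < 5 * m) :
    ¬ Amortised N B m := fun h => by
  have e := rate_law₄ hN h
  omega

/-- Level three: **`a(3,5) ≥ 7`**. [cite: CoppersmithWinograd1990, §7] -/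
theorem amortisedNumber_three_five : 7 ≤ amortisedNumber 3 5 := by
  have h := rate_amortisedNumber₄ (by norm_num : 1 ≤ 3) 5
  omega

/-- Level three: `⟨6⟩ ⊠ C₁^{⊠3} ⋭ ⟨5⟩ ⊠ ⟨2,2,2⟩^{⊠3}`. [cite: CoppersmithWinograd1990, §7] -/
theorem not_amortised_three_6_5 : ¬ Amortised 3 6 5 :=
  not_amortised_of_lt (by norm_num) (by norm_num)

/-- Level ten: `a(10, 100) ≥ 125`. [cite: CoppersmithWinograd1990, §7] -/
theorem amortisedNumber_ten_hundred : 125 ≤ amortisedNumber 10 100 := by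
  have h := rate_amortisedNumber₄ (by norm_num : 1 ≤ 10) 100
  omega

end Summit.MatrixMultiplication.MatrixMultiplication.Theorems.OutsiderSandwichLevelRateFour
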